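import Mathlib
import HarnessLib

/-!
# LINE g18-A v5 «top-channel cone cut» (crux ⟨stmt-QuantumFields-23125⟩ `RationalToGeneral`, route `F4SubCurvatureDoor`,
# skeleton `Cruxes/RationalToGeneral/Lines/sextic_channel.lean` @ 9dfcf5fb94f6) — RUNG for `stub_channelShellForm`, build-plan step C2′
# «no `W(F₄)`-invariant harmonics in degrees 1 … 5» — the algebraic half

Owner de-risking workfile (planner `ym-idea-3` g18; stub plans `Lines/sextic_channel_stubplans.md` §4).  The stub `ChannelShellForm` and
the proved-on-paper T2′ need, for the channels `0 < L < 6`, that a HARMONIC homogeneous polynomial on `ℝ⁴` of degree `L ∈ {1,…,5}` which is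
invariant under the Weyl group `W(F₄)` vanishes (this is where `F₄` beats `B₄`: the `W(B₄)`-invariant harmonic quartic `2Σxᵢ⁴ − ‖x‖⁴` exists and
slips under the budget — Prop B).  This file proves the COEFFICIENT MECHANICS, the degrees `L` odd and `L = 2` for a general finite
index type, and the degree `L = 4` on `ℝ⁴`, with invariance stated at the level of EVALUATIONS (as in `InClass`):

* `coeff_bind₁_C_mul_X` — coefficients under the diagonal substitution `X_j ↦ ε_j X_j`: `coeff m = (∏ ε_j^{m_j}) · coeff m`;
* `coeff_eq_zero_of_odd_exponent` — invariance under ONE sign flip `x_i ↦ −x_i` kills every monomial with `m_i` odd;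
* `eq_zero_of_isHomogeneous_odd` — odd degree + invariance under `x ↦ −x` ⇒ `P = 0`;
* `eq_zero_of_harmonic_even_symmetric_deg_two` — degree 2 + harmonic + sign flips + coordinate permutations ⇒ `P = 0`
  (`P = a‖x‖²`, `ΔP = 2a·#σ`).
* `eq_zero_of_harmonic_F4_deg_four` (§ E, on `ℝ⁴`) — degree 4 + harmonic + sign flips + permutations + the HADAMARD reflection
  `x ↦ x − ½(Σₖxₖ)𝟙` of `W(F₄)` ⇒ `P = 0`: coefficients `a = c(4eⱼ)`, `b = c(2eⱼ+2eₖ)` by transport; `Δ` at `x₀²` gives `12a + 6b = 0`;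
  Hadamard at `e₀ ↦ ½(1,−1,−1,−1)` gives `16a = Σ_d c_d = 4a + 6b` (shape count of the even quartic monomials); hence `a = b = 0`;
* `eq_zero_of_harmonic_F4_invariant_low_degree` — the assembled C2′: every `0 < L < 6`.
So the algebraic half of C2′ is COMPLETE here; what remains for `stub_channelShellForm` at these degrees is only the Fischer/harmonic
bookkeeping that feeds these hypotheses (stub plans §4 C3–C5).
HONEST LABEL: classical algebra [folklore]; closes no stub by itself; ⟨23125⟩, C3, R2d and the summit remain OPEN.
-/

namespace Summit.QuantumFields.YangMills.Cruxes.RationalToGeneral.SexticChannel.RungLowDegree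

open MvPolynomial
open scoped BigOperators

/-! ## § A. Coefficients under a diagonal rescaling of the variables -/

/-- `X_j ↦ ε_j X_j` maps the monomial `r·x^d` to `(r ∏ ε_j^{d_j})·x^d`. [folklore] -/
theorem bind₁_C_mul_X_monomial {σ R : Type*} [CommSemiring R] (ε : σ → R) (d : σ →₀ ℕ) (r : R) :
    bind₁ (fun j => C (ε j) * X j) (monomial d r) = monomial d (r * ∏ j ∈ d.support, ε j ^ d j) := by
  rw [bind₁_monomial]
  have h : (∏ j ∈ d.support, (C (ε j) * X j : MvPolynomial σ R) ^ d j)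
      = C (∏ j ∈ d.support, ε j ^ d j) * ∏ j ∈ d.support, (X j : MvPolynomial σ R) ^ d j := by
    rw [map_prod, ← Finset.prod_mul_distrib]
    exact Finset.prod_congr rfl fun j _ => by rw [mul_pow, map_pow]
  rw [h, ← mul_assoc, ← map_mul, monomial_eq]
  rfl

/-- Coefficients under the diagonal substitution `X_j ↦ ε_j X_j`. [folklore] -/
theorem coeff_bind₁_C_mul_X {σ R : Type*} [CommSemiring R] (ε : σ → R) (P : MvPolynomial σ R) (m : σ →₀ ℕ) :
    coeff m (bind₁ (fun j => C (ε j) * X j) P) = (∏ j ∈ m.support, ε j ^ m j) * coeff m P := by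
  classical
  induction P using MvPolynomial.induction_on' with
  | monomial d r =>
    rw [bind₁_C_mul_X_monomial, coeff_monomial, coeff_monomial]
    split_ifs with h
    · subst h; ring
    · simp
  | add p q hp hq => simp only [map_add, coeff_add, hp, hq, mul_add]

/-- Evaluation of a substituted polynomial. [folklore] -/
theorem eval_bind₁_eq {σ : Type*} (g : σ → MvPolynomial σ ℝ) (x : σ → ℝ) (P : MvPolynomial σ ℝ) :
    eval x (bind₁ g P) = eval (fun i => eval x (g i)) P :=
  eval₂Hom_bind₁ (RingHom.id ℝ) x g P

/-- An evaluation-level diagonal symmetry is a polynomial identity. [folklore] -/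
theorem bind₁_signs_eq_self {σ : Type*} {P : MvPolynomial σ ℝ} (ε : σ → ℝ)
    (hflip : ∀ x : σ → ℝ, eval (fun j => ε j * x j) P = eval x P) :
    bind₁ (fun j => C (ε j) * X j) P = P := by
  refine MvPolynomial.funext fun x => ?_
  rw [eval_bind₁_eq]
  have : (fun i => eval x (C (ε i) * X i)) = fun j => ε j * x j := by
    funext i; simp
  rw [this, hflip]

/-! ## § B. One sign flip kills the monomials with an odd exponent -/

/-- If `P(x₀,…,−x_i,…) = P(x)` for all real `x`, every monomial of `P` has an even exponent at `i`. [folklore] -/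
theorem coeff_eq_zero_of_odd_exponent {σ : Type*} [DecidableEq σ] {P : MvPolynomial σ ℝ} (i : σ)
    (hflip : ∀ x : σ → ℝ, eval (fun j => (if j = i then (-1 : ℝ) else 1) * x j) P = eval x P)
    (m : σ →₀ ℕ) (hodd : Odd (m i)) : coeff m P = 0 := by
  have hP := bind₁_signs_eq_self (P := P) (fun j => if j = i then (-1 : ℝ) else 1) hflip
  have hc := coeff_bind₁_C_mul_X (fun j => if j = i then (-1 : ℝ) else 1) P m
  rw [hP] at hc
  have hprod : (∏ j ∈ m.support, (if j = i then (-1 : ℝ) else 1) ^ m j) = (-1) ^ m i := by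
    rw [Finset.prod_eq_single i]
    · simp
    · intro j _ hji; simp [hji]
    · intro hi
      have : m i = 0 := by simpa [Finsupp.mem_support_iff] using hi
      rw [this]; simp
  rw [hprod, hodd.neg_one_pow] at hc
  linarith

/-! ## § C. Odd degrees -/

/-- `φ(t·x) = tⁿ φ(x)` for `φ` homogeneous of degree `n`. [folklore] -/
theorem eval_smul_of_isHomogeneous {σ : Type*} {φ : MvPolynomial σ ℝ} {n : ℕ} (hφ : φ.IsHomogeneous n)
    (t : ℝ) (x : σ → ℝ) : eval (t • x) φ = t ^ n * eval x φ := by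
  rw [eval_eq, eval_eq, Finset.mul_sum]
  refine Finset.sum_congr rfl fun d hd => ?_
  simp only [Pi.smul_apply, smul_eq_mul, mul_pow, Finset.prod_mul_distrib, Finset.prod_pow_eq_pow_sum]
  rw [← hφ.degree_eq_sum_deg_support hd]
  ring

/-- A homogeneous polynomial of ODD degree invariant under `x ↦ −x` is zero (degrees 1, 3, 5 of C2′; only the product of the four
sign flips of `W(B₄)` is used). [folklore] -/
theorem eq_zero_of_isHomogeneous_odd {σ : Type*} {P : MvPolynomial σ ℝ} {L : ℕ} (hhom : P.IsHomogeneous L) (hL : Odd L)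
    (hneg : ∀ x : σ → ℝ, eval (fun j => -x j) P = eval x P) : P = 0 := by
  refine MvPolynomial.funext fun x => ?_
  have h1 := eval_smul_of_isHomogeneous hhom (-1) x
  have h2 : ((-1 : ℝ) • x) = fun j => -x j := by
    funext j; simp
  rw [h2, hneg x, hL.neg_one_pow] at h1
  rw [map_zero]
  linarith

/-! ## § D. Degree two -/

/-- Evaluation-level permutation symmetry is `rename`-invariance. [folklore] -/
theorem rename_eq_self_of_eval_perm {σ : Type*} {P : MvPolynomial σ ℝ} (τ : Equiv.Perm σ)
    (hperm : ∀ x : σ → ℝ, eval (x ∘ τ) P = eval x P) : rename τ P = P := by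
  refine MvPolynomial.funext fun x => ?_
  rw [eval_rename]
  exact hperm x

/-- Coefficient transport along a symmetry permutation. [folklore] -/
theorem coeff_mapDomain_eq_of_rename_eq {σ : Type*} {P : MvPolynomial σ ℝ} (τ : Equiv.Perm σ) (hτ : rename τ P = P)
    (d : σ →₀ ℕ) : coeff (Finsupp.mapDomain τ d) P = coeff d P := by
  have h := coeff_rename_mapDomain τ τ.injective P d
  rwa [hτ] at h

/-- The Laplacian's constant coefficient: `coeff 0 (Σᵢ ∂ᵢ²P) = 2 Σᵢ coeff (2eᵢ) P`. [folklore] -/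
theorem coeff_zero_laplacian {σ : Type*} [Fintype σ] [DecidableEq σ] (P : MvPolynomial σ ℝ) :
    coeff 0 (∑ i : σ, pderiv i (pderiv i P)) = ∑ i : σ, 2 * coeff (Finsupp.single i 2) P := by
  rw [coeff_sum]
  refine Finset.sum_congr rfl fun i _ => ?_
  rw [coeff_pderiv, coeff_pderiv, zero_add, ← Finsupp.single_add]
  simp only [Finsupp.coe_zero, Pi.zero_apply, Finsupp.single_eq_same]
  norm_num
  ring

/-- An even-exponent monomial of degree two is `2eᵢ`. [folklore] -/
theorem eq_single_two_of_even_of_degree_two {σ : Type*} [Fintype σ] [DecidableEq σ] (d : σ →₀ ℕ)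
    (heven : ∀ j, Even (d j)) (hdeg : d.degree = 2) : ∃ i, d = Finsupp.single i 2 := by
  rw [Finsupp.degree_eq_sum] at hdeg
  have hex : ∃ i, d i ≠ 0 := by
    by_contra h
    push Not at h
    have : ∑ i, d i = 0 := Finset.sum_eq_zero fun i _ => h i
    omega
  obtain ⟨i, hi⟩ := hex
  have hle : d i ≤ 2 := by
    rw [← hdeg]; exact Finset.single_le_sum (fun j _ => Nat.zero_le (d j)) (Finset.mem_univ i)
  obtain ⟨t, ht⟩ := heven i
  have hdi : d i = 2 := by omega
  have hrest : ∀ j, j ≠ i → d j = 0 := by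
    intro j hji
    have hsplit := Finset.add_sum_erase Finset.univ (fun k => d k) (Finset.mem_univ i)
    have hzero : ∑ k ∈ Finset.univ.erase i, d k = 0 := by omega
    exact (Finset.sum_eq_zero_iff.mp hzero) j (Finset.mem_erase.mpr ⟨hji, Finset.mem_univ j⟩)
  refine ⟨i, Finsupp.ext fun j => ?_⟩
  by_cases hji : j = i
  · subst hji; simp [hdi]
  · rw [hrest j hji, Finsupp.single_eq_of_ne hji]

/-- **C2′, degree two**: a harmonic homogeneous quadratic polynomial which is invariant (at the level of evaluations) under
every single sign flip and every permutation of the coordinates is zero (`P = a‖x‖²` and `ΔP = 2a·#σ`). [folklore] -/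
theorem eq_zero_of_harmonic_even_symmetric_deg_two {σ : Type*} [Fintype σ] [DecidableEq σ] {P : MvPolynomial σ ℝ}
    (hhom : P.IsHomogeneous 2) (hharm : ∑ i : σ, pderiv i (pderiv i P) = 0)
    (hsign : ∀ i : σ, ∀ x : σ → ℝ, eval (fun j => (if j = i then (-1 : ℝ) else 1) * x j) P = eval x P)
    (hperm : ∀ τ : Equiv.Perm σ, ∀ x : σ → ℝ, eval (x ∘ τ) P = eval x P) : P = 0 := by
  -- all diagonal coefficients agree
  have hdiag : ∀ i j : σ, coeff (Finsupp.single j 2) P = coeff (Finsupp.single i 2) P := by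
    intro i j
    have h := coeff_mapDomain_eq_of_rename_eq (Equiv.swap i j) (rename_eq_self_of_eval_perm _ (hperm _))
      (Finsupp.single i 2)
    rwa [Finsupp.mapDomain_single, Equiv.swap_apply_left] at h
  -- harmonicity: the common diagonal coefficient vanishes
  have hzero : ∀ i : σ, coeff (Finsupp.single i 2) P = 0 := by
    intro i
    have h := congrArg (coeff (0 : σ →₀ ℕ)) hharm
    rw [coeff_zero_laplacian, coeff_zero] at h
    rw [Finset.sum_congr rfl fun j _ => by rw [hdiag i j]] at h
    rw [Finset.sum_const, Finset.card_univ, nsmul_eq_mul] at h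
    have hcard : (0 : ℝ) < Fintype.card σ := by
      exact_mod_cast Fintype.card_pos_iff.mpr ⟨i⟩
    nlinarith
  -- conclude coefficientwise
  ext d
  rw [coeff_zero]
  by_cases hdeg : d.degree = 2
  · by_cases hodd : ∃ i, Odd (d i)
    · obtain ⟨i, hi⟩ := hodd
      exact coeff_eq_zero_of_odd_exponent i (hsign i) d hi
    · push Not at hodd
      obtain ⟨i, rfl⟩ := eq_single_two_of_even_of_degree_two d (fun j => Nat.not_odd_iff_even.mp (hodd j)) hdeg
      exact hzero i
  · exact hhom.coeff_eq_zero hdeg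


/-- Evaluation at a coordinate vector picks the pure-power coefficient of a homogeneous polynomial. [folklore] -/
theorem eval_indicator_eq_coeff_single {σ : Type*} [Fintype σ] [DecidableEq σ] {P : MvPolynomial σ ℝ} {L : ℕ}
    (hhom : P.IsHomogeneous L) (j : σ) :
    eval (fun i => if i = j then (1 : ℝ) else 0) P = coeff (Finsupp.single j L) P := by
  rw [eval_eq']
  have key : ∀ d ∈ P.support, coeff d P * ∏ i, (if i = j then (1 : ℝ) else 0) ^ d i
      = if d = Finsupp.single j L then coeff d P else 0 := by
    intro d hd
    have hdeg : d.degree = L := by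
      by_contra h; exact (mem_support_iff.mp hd) (hhom.coeff_eq_zero h)
    by_cases h : d = Finsupp.single j L
    · rw [if_pos h]
      have hone : (∏ i, (if i = j then (1 : ℝ) else 0) ^ d i) = 1 := by
        refine Finset.prod_eq_one fun i _ => ?_
        by_cases hij : i = j
        · rw [if_pos hij, one_pow]
        · have : d i = 0 := by rw [h, Finsupp.single_apply, if_neg (Ne.symm hij)]
          rw [this, pow_zero]
      rw [hone, mul_one]
    · rw [if_neg h]
      have hex : ∃ i, i ≠ j ∧ d i ≠ 0 := by
        by_contra hno
        push Not at hno
        apply h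
        ext i
        by_cases hij : i = j
        · subst hij
          rw [Finsupp.single_eq_same, ← hdeg, Finsupp.degree_eq_sum,
            ← Finset.add_sum_erase _ _ (Finset.mem_univ i)]
          rw [Finset.sum_eq_zero fun k hk => hno k (Finset.ne_of_mem_erase hk)]
          simp
        · rw [hno i hij, Finsupp.single_apply, if_neg (Ne.symm hij)]
      obtain ⟨i, hij, hi⟩ := hex
      have hz : (∏ i, (if i = j then (1 : ℝ) else 0) ^ d i) = 0 :=
        Finset.prod_eq_zero (Finset.mem_univ i) (by rw [if_neg hij]; exact zero_pow hi)
      rw [hz, mul_zero]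
  rw [Finset.sum_congr rfl key, Finset.sum_ite_eq']
  split_ifs with hmem
  · rfl
  · symm; simpa [mem_support_iff] using hmem

/-! ## § E. Degree four on `ℝ⁴` — the `F₄` step (Hadamard reflection) -/

section DegFour

variable {P : MvPolynomial (Fin 4) ℝ}

/-- Monomials in the support of a sign-symmetric homogeneous quartic: even exponents, degree four. -/
theorem even_and_degree_of_mem_support (hhom : P.IsHomogeneous 4)
    (hsign : ∀ i : Fin 4, ∀ x : Fin 4 → ℝ, eval (fun j => (if j = i then (-1 : ℝ) else 1) * x j) P = eval x P)
    {d : Fin 4 →₀ ℕ} (hd : d ∈ P.support) : (∀ i, Even (d i)) ∧ d.degree = 4 := by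
  refine ⟨fun i => ?_, ?_⟩
  · by_contra h
    rw [Nat.not_even_iff_odd] at h
    exact (mem_support_iff.mp hd) (coeff_eq_zero_of_odd_exponent i (hsign i) d h)
  · by_contra h
    exact (mem_support_iff.mp hd) (hhom.coeff_eq_zero h)

set_option linter.unusedTactic false in
set_option linter.unreachableTactic false in
/-- The even monomials of degree four in four variables: `4eⱼ` or `2eⱼ + 2eₖ` (`j < k`). [folklore] -/
theorem shape_of_even_degree_four (d : Fin 4 →₀ ℕ) (heven : ∀ i, Even (d i)) (hdeg : d.degree = 4) :
    (∃ j, d = Finsupp.single j 4) ∨ (∃ j k, j < k ∧ d = Finsupp.single j 2 + Finsupp.single k 2) := by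
  rw [Finsupp.degree_eq_sum, Fin.sum_univ_four] at hdeg
  obtain ⟨t0, h0⟩ := heven 0
  obtain ⟨t1, h1⟩ := heven 1
  obtain ⟨t2, h2⟩ := heven 2
  obtain ⟨t3, h3⟩ := heven 3
  have c0 : d 0 = 0 ∨ d 0 = 2 ∨ d 0 = 4 := by omega
  have c1 : d 1 = 0 ∨ d 1 = 2 ∨ d 1 = 4 := by omega
  have c2 : d 2 = 0 ∨ d 2 = 2 ∨ d 2 = 4 := by omega
  have c3 : d 3 = 0 ∨ d 3 = 2 ∨ d 3 = 4 := by omega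
  have mk4 : ∀ j : Fin 4, (∀ q, d q = if q = j then 4 else 0) → d = Finsupp.single j 4 := by
    intro j h; ext q; rw [h q, Finsupp.single_apply]
    rcases eq_or_ne q j with rfl | hq
    · simp
    · simp [hq, Ne.symm hq]
  have mk22 : ∀ j k : Fin 4, j < k → (∀ q, d q = (if q = j then 2 else 0) + (if q = k then 2 else 0)) →
      d = Finsupp.single j 2 + Finsupp.single k 2 := by
    intro j k _ h; ext q
    rw [h q, Finsupp.add_apply, Finsupp.single_apply, Finsupp.single_apply]
    rcases eq_or_ne q j with rfl | hq <;> rcases eq_or_ne q k with rfl | hq'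
    · simp
    · simp [hq', Ne.symm hq']
    · simp [hq, Ne.symm hq]
    · simp [hq, hq', Ne.symm hq, Ne.symm hq']
  clear h0 h1 h2 h3
  rcases c0 with a0 | a0 | a0 <;> rcases c1 with a1 | a1 | a1 <;> rcases c2 with a2 | a2 | a2 <;>
    rcases c3 with a3 | a3 | a3 <;>
    first
    | (exfalso; omega)
    | (refine Or.inl ⟨0, mk4 0 fun q => ?_⟩; fin_cases q <;> simp [a0, a1, a2, a3] <;> decide)
    | (refine Or.inl ⟨1, mk4 1 fun q => ?_⟩; fin_cases q <;> simp [a0, a1, a2, a3] <;> decide)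
    | (refine Or.inl ⟨2, mk4 2 fun q => ?_⟩; fin_cases q <;> simp [a0, a1, a2, a3] <;> decide)
    | (refine Or.inl ⟨3, mk4 3 fun q => ?_⟩; fin_cases q <;> simp [a0, a1, a2, a3] <;> decide)
    | (refine Or.inr ⟨0, 1, by decide, mk22 0 1 (by decide) fun q => ?_⟩;
        fin_cases q <;> simp [a0, a1, a2, a3] <;> decide)
    | (refine Or.inr ⟨0, 2, by decide, mk22 0 2 (by decide) fun q => ?_⟩;
        fin_cases q <;> simp [a0, a1, a2, a3] <;> decide)
    | (refine Or.inr ⟨0, 3, by decide, mk22 0 3 (by decide) fun q => ?_⟩;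
        fin_cases q <;> simp [a0, a1, a2, a3] <;> decide)
    | (refine Or.inr ⟨1, 2, by decide, mk22 1 2 (by decide) fun q => ?_⟩;
        fin_cases q <;> simp [a0, a1, a2, a3] <;> decide)
    | (refine Or.inr ⟨1, 3, by decide, mk22 1 3 (by decide) fun q => ?_⟩;
        fin_cases q <;> simp [a0, a1, a2, a3] <;> decide)
    | (refine Or.inr ⟨2, 3, by decide, mk22 2 3 (by decide) fun q => ?_⟩;
        fin_cases q <;> simp [a0, a1, a2, a3] <;> decide)

/-- Values of a pair monomial. -/
theorem pair_apply (j k q : Fin 4) :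
    (Finsupp.single j 2 + Finsupp.single k 2 : Fin 4 →₀ ℕ) q = (if j = q then 2 else 0) + (if k = q then 2 else 0) := by
  rw [Finsupp.add_apply, Finsupp.single_apply, Finsupp.single_apply]

/-- A pair monomial is not a fourth power of one variable. -/
theorem pair_ne_single_four {j k : Fin 4} (hjk : j < k) (j' : Fin 4) :
    Finsupp.single j 2 + Finsupp.single k 2 ≠ Finsupp.single j' 4 := by
  intro h
  have h1 : (Finsupp.single j 2 + Finsupp.single k 2 : Fin 4 →₀ ℕ) j = (Finsupp.single j' 4 : Fin 4 →₀ ℕ) j := by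
    rw [h]
  have hne : k ≠ j := ne_of_gt hjk
  rw [pair_apply, if_pos rfl, if_neg hne, Finsupp.single_apply] at h1
  split_ifs at h1 <;> omega

/-- Ordered pairs determine the pair monomial injectively. -/
theorem pair_inj {j k j' k' : Fin 4} (hjk : j < k) (hjk' : j' < k')
    (h : (Finsupp.single j 2 + Finsupp.single k 2 : Fin 4 →₀ ℕ) = Finsupp.single j' 2 + Finsupp.single k' 2) :
    j = j' ∧ k = k' := by
  have hj : (Finsupp.single j 2 + Finsupp.single k 2 : Fin 4 →₀ ℕ) j
      = (Finsupp.single j' 2 + Finsupp.single k' 2 : Fin 4 →₀ ℕ) j := by rw [h]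
  have hk : (Finsupp.single j 2 + Finsupp.single k 2 : Fin 4 →₀ ℕ) k
      = (Finsupp.single j' 2 + Finsupp.single k' 2 : Fin 4 →₀ ℕ) k := by rw [h]
  have hne : k ≠ j := ne_of_gt hjk
  have hne' : j ≠ k := ne_of_lt hjk
  rw [pair_apply, pair_apply, if_pos rfl, if_neg hne] at hj
  rw [pair_apply, pair_apply, if_neg hne', if_pos rfl] at hk
  have dj : j' = j ∨ k' = j := by
    by_contra hno; push Not at hno; rw [if_neg hno.1, if_neg hno.2] at hj; omega
  have dk : j' = k ∨ k' = k := by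
    by_contra hno; push Not at hno; rw [if_neg hno.1, if_neg hno.2] at hk; omega
  simp only [Fin.ext_iff, Fin.lt_def] at dj dk hjk hjk' ⊢
  omega

/-- The ordered index pairs. -/
def pairs : Finset (Fin 4 × Fin 4) := Finset.univ.filter fun p => p.1 < p.2

theorem card_pairs : pairs.card = 6 := by decide

theorem mem_pairs {p : Fin 4 × Fin 4} : p ∈ pairs ↔ p.1 < p.2 := by
  simp [pairs]

/-- The sum of all coefficients of an even quartic, organised by shape:
`Σ_{d ∈ supp} c_d = Σⱼ c(4eⱼ) + Σ_{j<k} c(2eⱼ+2eₖ)`. [folklore] -/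
theorem sum_coeff_eq_shapes (hhom : P.IsHomogeneous 4)
    (hsign : ∀ i : Fin 4, ∀ x : Fin 4 → ℝ, eval (fun j => (if j = i then (-1 : ℝ) else 1) * x j) P = eval x P) :
    ∑ d ∈ P.support, coeff d P
      = ∑ j : Fin 4, coeff (Finsupp.single j 4) P
        + ∑ p ∈ pairs, coeff (Finsupp.single p.1 2 + Finsupp.single p.2 2) P := by
  classical
  -- re-express the two shape sums as sums over the support
  have hS1 : ∑ j : Fin 4, coeff (Finsupp.single j 4) P
      = ∑ d ∈ P.support, ∑ j : Fin 4, (if d = Finsupp.single j 4 then coeff d P else 0) := by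
    rw [Finset.sum_comm]
    refine Finset.sum_congr rfl fun j _ => ?_
    rw [Finset.sum_ite_eq' P.support (Finsupp.single j 4) fun d => coeff d P]
    split_ifs with hmem
    · rfl
    · simpa [mem_support_iff] using hmem
  have hS2 : ∑ p ∈ pairs, coeff (Finsupp.single p.1 2 + Finsupp.single p.2 2) P
      = ∑ d ∈ P.support, ∑ p ∈ pairs,
          (if d = Finsupp.single p.1 2 + Finsupp.single p.2 2 then coeff d P else 0) := by
    rw [Finset.sum_comm]
    refine Finset.sum_congr rfl fun p _ => ?_
    rw [Finset.sum_ite_eq' P.support (Finsupp.single p.1 2 + Finsupp.single p.2 2) fun d => coeff d P]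
    split_ifs with hmem
    · rfl
    · simpa [mem_support_iff] using hmem
  rw [hS1, hS2, ← Finset.sum_add_distrib]
  refine Finset.sum_congr rfl fun d hd => ?_
  obtain ⟨heven, hdeg⟩ := even_and_degree_of_mem_support hhom hsign hd
  rcases shape_of_even_degree_four d heven hdeg with ⟨j₀, rfl⟩ | ⟨j₀, k₀, hlt, rfl⟩
  · -- pure fourth power: first inner sum picks it, second vanishes
    have h1 : ∑ j : Fin 4, (if Finsupp.single j₀ 4 = Finsupp.single j 4 then coeff (Finsupp.single j₀ 4) P else 0)
        = coeff (Finsupp.single j₀ 4) P := by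
      have : ∀ j : Fin 4, (Finsupp.single j₀ 4 = Finsupp.single j 4) ↔ (j₀ = j) := fun j =>
        (Finsupp.single_left_injective (by norm_num : (4 : ℕ) ≠ 0)).eq_iff
      simp_rw [this]
      rw [Finset.sum_ite_eq]; simp
    have h2 : ∑ p ∈ pairs, (if Finsupp.single j₀ 4 = Finsupp.single p.1 2 + Finsupp.single p.2 2
        then coeff (Finsupp.single j₀ 4) P else 0) = 0 := by
      refine Finset.sum_eq_zero fun p hp => ?_
      rw [if_neg]
      exact fun h => pair_ne_single_four (mem_pairs.mp hp) j₀ h.symm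
    rw [h1, h2, add_zero]
  · -- pair: first inner sum vanishes, second picks exactly the ordered pair
    have h1 : ∑ j : Fin 4, (if Finsupp.single j₀ 2 + Finsupp.single k₀ 2 = Finsupp.single j 4
        then coeff (Finsupp.single j₀ 2 + Finsupp.single k₀ 2) P else 0) = 0 := by
      refine Finset.sum_eq_zero fun j _ => ?_
      rw [if_neg (pair_ne_single_four hlt j)]
    have h2 : ∑ p ∈ pairs, (if Finsupp.single j₀ 2 + Finsupp.single k₀ 2 = Finsupp.single p.1 2 + Finsupp.single p.2 2
        then coeff (Finsupp.single j₀ 2 + Finsupp.single k₀ 2) P else 0)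
        = coeff (Finsupp.single j₀ 2 + Finsupp.single k₀ 2) P := by
      rw [Finset.sum_eq_single (j₀, k₀)]
      · simp
      · intro p hp hne
        rw [if_neg]
        intro h
        obtain ⟨e1, e2⟩ := pair_inj hlt (mem_pairs.mp hp) h
        exact hne (Prod.ext e1.symm e2.symm)
      · intro hnot
        exact absurd (mem_pairs.mpr hlt) hnot
    rw [h1, h2, zero_add]

/-- Coefficient transport for pair monomials under the coordinate permutations. -/
theorem coeff_pair_eq (hperm : ∀ τ : Equiv.Perm (Fin 4), ∀ x : Fin 4 → ℝ, eval (x ∘ τ) P = eval x P)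
    {j k : Fin 4} (hjk : j ≠ k) :
    coeff (Finsupp.single j 2 + Finsupp.single k 2) P = coeff (Finsupp.single 0 2 + Finsupp.single 1 2) P := by
  set m : Fin 4 := Equiv.swap 0 j k with hm_def
  have hm : m ≠ 0 := by
    intro h
    apply hjk
    have := congrArg (Equiv.swap (0 : Fin 4) j) h
    rw [hm_def, Equiv.swap_apply_self, Equiv.swap_apply_left] at this
    exact this.symm
  set τ : Equiv.Perm (Fin 4) := (Equiv.swap 1 m).trans (Equiv.swap 0 j) with hτ_def
  have hτ0 : τ 0 = j := by
    rw [hτ_def, Equiv.trans_apply, Equiv.swap_apply_of_ne_of_ne (by decide) hm.symm, Equiv.swap_apply_left]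
  have hτ1 : τ 1 = k := by
    rw [hτ_def, Equiv.trans_apply, Equiv.swap_apply_left, hm_def, Equiv.swap_apply_self]
  have h := coeff_mapDomain_eq_of_rename_eq τ (rename_eq_self_of_eval_perm τ (hperm τ))
    (Finsupp.single 0 2 + Finsupp.single 1 2)
  rw [Finsupp.mapDomain_add, Finsupp.mapDomain_single, Finsupp.mapDomain_single, hτ0, hτ1] at h
  exact h

/-- **C2′, degree four — where `F₄` beats `B₄`**: a harmonic homogeneous quartic on `ℝ⁴` invariant (at the level of evaluations)
under the sign flips, the coordinate permutations AND the Hadamard reflection `x ↦ x − ½(Σₖxₖ)(1,1,1,1)` of `W(F₄)` is zero.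
(`W(B₄)` alone leaves `2Σxᵢ⁴ − ‖x‖⁴`; the Hadamard reflection at `e₀ ↦ ½(1,−1,−1,−1)` forces `16a = 4a + 6b` against the harmonic
`12a + 6b = 0`.) [folklore; Celmaster 1982 doi:10.1103/physrevd.26.2955 for the F₄ isotropy order] -/
theorem eq_zero_of_harmonic_F4_deg_four (hhom : P.IsHomogeneous 4) (hharm : ∑ i : Fin 4, pderiv i (pderiv i P) = 0)
    (hsign : ∀ i : Fin 4, ∀ x : Fin 4 → ℝ, eval (fun j => (if j = i then (-1 : ℝ) else 1) * x j) P = eval x P)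
    (hperm : ∀ τ : Equiv.Perm (Fin 4), ∀ x : Fin 4 → ℝ, eval (x ∘ τ) P = eval x P)
    (hHad : ∀ x : Fin 4 → ℝ, eval (fun j => x j - (1 / 2) * ∑ k, x k) P = eval x P) : P = 0 := by
  classical
  set a : ℝ := coeff (Finsupp.single (0 : Fin 4) 4) P with ha_def
  set b : ℝ := coeff (Finsupp.single (0 : Fin 4) 2 + Finsupp.single 1 2) P with hb_def
  -- symmetry of the coefficients
  have ha : ∀ j : Fin 4, coeff (Finsupp.single j 4) P = a := by
    intro j
    have h := coeff_mapDomain_eq_of_rename_eq (Equiv.swap 0 j) (rename_eq_self_of_eval_perm _ (hperm _))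
      (Finsupp.single 0 4)
    rwa [Finsupp.mapDomain_single, Equiv.swap_apply_left] at h
  have hb : ∀ j k : Fin 4, j ≠ k → coeff (Finsupp.single j 2 + Finsupp.single k 2) P = b :=
    fun j k hjk => coeff_pair_eq hperm hjk
  -- harmonicity at the monomial `x₀²`: 12a + 6b = 0
  have hH : 12 * a + 6 * b = 0 := by
    have h := congrArg (coeff (Finsupp.single (0 : Fin 4) 2)) hharm
    rw [coeff_sum, coeff_zero, Fin.sum_univ_four] at h
    simp only [coeff_pderiv] at h
    have e00 : (Finsupp.single (0 : Fin 4) 2 + Finsupp.single 0 1 + Finsupp.single 0 1 : Fin 4 →₀ ℕ)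
        = Finsupp.single 0 4 := by
      rw [← Finsupp.single_add, ← Finsupp.single_add]
    have e0i : ∀ i : Fin 4, (Finsupp.single (0 : Fin 4) 2 + Finsupp.single i 1 + Finsupp.single i 1 : Fin 4 →₀ ℕ)
        = Finsupp.single 0 2 + Finsupp.single i 2 := by
      intro i; rw [add_assoc, ← Finsupp.single_add]
    rw [e00, e0i 1, e0i 2, e0i 3, ha 0, hb 0 1 (by decide), hb 0 2 (by decide), hb 0 3 (by decide)] at h
    simp only [Finsupp.add_apply, Finsupp.single_apply] at h
    norm_num at h
    linarith
  -- Hadamard reflection at e₀: 16 a = Σ_{d ∈ supp} c_d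
  have hE : 16 * a = ∑ d ∈ P.support, coeff d P := by
    have h := hHad (fun j => if j = 0 then 1 else 0)
    rw [eval_indicator_eq_coeff_single hhom 0] at h
    have hpt : (fun j : Fin 4 => (if j = 0 then (1 : ℝ) else 0) - 1 / 2 * ∑ k : Fin 4, (if k = 0 then (1 : ℝ) else 0))
        = fun j => if j = 0 then (1 / 2 : ℝ) else -(1 / 2) := by
      funext j
      rw [Fin.sum_univ_four]
      have h10 : (1 : Fin 4) ≠ 0 := by decide
      have h20 : (2 : Fin 4) ≠ 0 := by decide
      have h30 : (3 : Fin 4) ≠ 0 := by decide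
      rw [if_pos rfl, if_neg h10, if_neg h20, if_neg h30]
      by_cases hj : j = 0
      · rw [if_pos hj, if_pos hj]; norm_num
      · rw [if_neg hj, if_neg hj]; norm_num
    rw [hpt, eval_eq'] at h
    have hterm : ∀ d ∈ P.support,
        coeff d P * ∏ i : Fin 4, (if i = 0 then (1 / 2 : ℝ) else -(1 / 2)) ^ d i = coeff d P * (1 / 16) := by
      intro d hd
      obtain ⟨heven, hdeg⟩ := even_and_degree_of_mem_support hhom hsign hd
      have hfac : ∀ i : Fin 4, (if i = 0 then (1 / 2 : ℝ) else -(1 / 2)) ^ d i = (1 / 2 : ℝ) ^ d i := by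
        intro i
        by_cases hi : i = 0
        · rw [if_pos hi]
        · rw [if_neg hi, (heven i).neg_pow]
      rw [Finset.prod_congr rfl fun i _ => hfac i, Finset.prod_pow_eq_pow_sum, ← Finsupp.degree_eq_sum, hdeg]
      norm_num
    rw [Finset.sum_congr rfl hterm, ← Finset.sum_mul] at h
    linarith
  -- the shape count: Σ c_d = 4a + 6b
  have hS : ∑ d ∈ P.support, coeff d P = 4 * a + 6 * b := by
    rw [sum_coeff_eq_shapes hhom hsign]
    rw [Finset.sum_congr rfl fun j _ => ha j]
    rw [Finset.sum_congr rfl fun p hp => hb p.1 p.2 (ne_of_lt (mem_pairs.mp hp))]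
    rw [Finset.sum_const, Finset.sum_const, Finset.card_univ, Fintype.card_fin, card_pairs]
    simp only [nsmul_eq_mul]
    push_cast
    ring
  have ha0 : a = 0 := by linarith
  have hb0 : b = 0 := by linarith
  -- every coefficient vanishes
  ext d
  rw [coeff_zero]
  by_cases hd : d ∈ P.support
  · obtain ⟨heven, hdeg⟩ := even_and_degree_of_mem_support hhom hsign hd
    rcases shape_of_even_degree_four d heven hdeg with ⟨j, rfl⟩ | ⟨j, k, hlt, rfl⟩
    · rw [ha j, ha0]
    · rw [hb j k (ne_of_lt hlt), hb0]
  · simpa [mem_support_iff] using hd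

/-- **C2′ assembled (all low degrees).** For `0 < L < 6`, a harmonic homogeneous polynomial of degree `L` on `ℝ⁴` which is invariant —
at the level of evaluations — under the four sign flips, the coordinate permutations and the Hadamard reflection (together generating
`W(F₄) ⊇ W(B₄)`) vanishes.  Odd `L`: `−1 ∈ W`; `L = 2`: `B₄`; `L = 4`: the `F₄` step.  HONEST LABEL: classical; no stub closes by this. -/
theorem eq_zero_of_harmonic_F4_invariant_low_degree {L : ℕ} (hL0 : 0 < L) (hL6 : L < 6) (hhom : P.IsHomogeneous L)
    (hharm : ∑ i : Fin 4, pderiv i (pderiv i P) = 0)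
    (hsign : ∀ i : Fin 4, ∀ x : Fin 4 → ℝ, eval (fun j => (if j = i then (-1 : ℝ) else 1) * x j) P = eval x P)
    (hperm : ∀ τ : Equiv.Perm (Fin 4), ∀ x : Fin 4 → ℝ, eval (x ∘ τ) P = eval x P)
    (hHad : ∀ x : Fin 4 → ℝ, eval (fun j => x j - (1 / 2) * ∑ k, x k) P = eval x P) : P = 0 := by
  -- the full sign reversal is the product of the four flips
  have hneg : ∀ x : Fin 4 → ℝ, eval (fun j => -x j) P = eval x P := by
    intro x
    have e : (fun j : Fin 4 => -x j) = fun j => (if j = (0 : Fin 4) then (-1 : ℝ) else 1) *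
        ((if j = (1 : Fin 4) then (-1 : ℝ) else 1) * ((if j = (2 : Fin 4) then (-1 : ℝ) else 1) *
          ((if j = (3 : Fin 4) then (-1 : ℝ) else 1) * x j))) := by
      funext j; fin_cases j <;> simp
    have h0 := hsign 0 (fun j => (if j = (1 : Fin 4) then (-1 : ℝ) else 1) * ((if j = (2 : Fin 4) then (-1 : ℝ) else 1) *
          ((if j = (3 : Fin 4) then (-1 : ℝ) else 1) * x j)))
    have h1 := hsign 1 (fun j => (if j = (2 : Fin 4) then (-1 : ℝ) else 1) * ((if j = (3 : Fin 4) then (-1 : ℝ) else 1) * x j))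
    have h2 := hsign 2 (fun j => (if j = (3 : Fin 4) then (-1 : ℝ) else 1) * x j)
    have h3 := hsign 3 x
    rw [e, h0, h1, h2, h3]
  interval_cases L
  · exact eq_zero_of_isHomogeneous_odd hhom (by decide) hneg
  · exact eq_zero_of_harmonic_even_symmetric_deg_two hhom hharm hsign hperm
  · exact eq_zero_of_isHomogeneous_odd hhom (by decide) hneg
  · exact eq_zero_of_harmonic_F4_deg_four hhom hharm hsign hperm hHad
  · exact eq_zero_of_isHomogeneous_odd hhom (by decide) hneg

end DegFour

end Summit.QuantumFields.YangMills.Cruxes.RationalToGeneral.SexticChannel.RungLowDegree
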